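import Summits.Ventures.YMGap.Thresholds.SharpClusteringEnergy
import Summits.Ventures.YMGap.Thresholds.SharpClusteringDensity
import HarnessLib

/-!
# Venture YMGap — static exponential clustering, Part III:
# the weighted covariance bound for a Gibbs measure `e^S σ^{⊗E}` on `SU(N)^E`

HONEST FRAMING: venture file (cell `pub-ymgap`, track (a), seat lit-1). This is the finite-volume
heart of the static (semigroup-free) proof of Shen–Zhu–Zhu's mass-gap step
(`shenZhuZhu_massGap_transfer`): for a smooth polynomial potential `S` on `SU(N)^E` with the
Hessian bounds of Part I (`HessBound S Λ`, `OffDiagHessBound S h`, `h ≥ 0` symmetric with row sums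
`≤ H`) and admissible weights `w` (ratio `ρ`), and `K = N/2 - Λ - (√ρ - 1)H > 0`,

  `K · |Z ∫ e^S fg - (∫ e^S f)(∫ e^S g)| ≤ Z · (∫ e^S Γ^{1/w}(f,f))^{1/2} (∫ e^S Γ^{w}(g,g))^{1/2}`,
  `Z = ∫ e^S dσ^{⊗E}`  (`covariance_le`),

i.e. `|Cov_{μ_S}(f,g)| ≤ K⁻¹ ‖∇f‖_{L²(μ_S; w⁻¹)} ‖∇g‖_{L²(μ_S; w)}`. With `w_e = e^{2c·dist(e, supp ∇g)}`
(Part IV) the right side is `e^{-c·d(supp ∇f, supp ∇g)}`-small: exponential clustering with a rate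
and constants uniform in `|E|`.

Proof (no semigroup, no spectral theorem, no elliptic regularity): write `g - ⟨g⟩ = L_S v_k + o(1)`
in `H¹(μ_S)` (Part II, `exists_approx_poisson`); then `∫ e^S f (g - ⟨g⟩) = -∫ e^S Γ(f, v_k) + o(1)`,
`|∫ e^S Γ(f,v_k)| ≤ ‖∇f‖_{w⁻¹} ‖∇v_k‖_{w}` (mixed-weight Cauchy–Schwarz) and
`K ‖∇v_k‖_w ≤ ‖∇L_S v_k‖_w → ‖∇g‖_w` (the weighted energy estimate of Part I-c, `weightedEnergy_le`).

## References

* H. Shen, R. Zhu, X. Zhu, CMP 400 (2023), Cor. 4.11 (the statement being re-proved statically).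
* B. Helffer, J. Sjöstrand, J. Stat. Phys. 74 (1994) 349–409; B. Helffer, J. Funct. Anal. 155 (1998)
  571–586 (Witten-Laplacian / weighted-energy route to correlation decay).
-/

noncomputable section

open scoped Matrix ComplexConjugate BigOperators Matrix.Norms.Frobenius ContDiff Topology
open Matrix Complex Finset MeasureTheory Filter
open Literature.MathematicalPhysics.QuantumFieldTheory

namespace Summit.Ventures.YMGap

namespace SharpClustering

open LatticeBakryEmery

universe u

variable {ι : Type u} [Fintype ι] [DecidableEq ι] {N : ℕ}

/-! ### Mixed-weight Cauchy–Schwarz -/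

/-- `|Γ(u,v)| ≤ √Γ^{1/w}(u,u) √Γ^{w}(v,v)` for positive weights. -/
theorem abs_Gam_le_sqrt_GamW_inv (w : ι → ℝ) (hw : ∀ e, 0 < w e) (u v : Cfg ι N → ℝ) (Q : Cfg ι N) :
    |Gam u v Q| ≤ Real.sqrt (GamW (fun e => (w e)⁻¹) u u Q) * Real.sqrt (GamW w v v Q) := by
  have key : ∀ a : BIdx ι N, algD (bframe a) u Q * algD (bframe a) v Q =
      (Real.sqrt ((w a.1)⁻¹) * algD (bframe a) u Q) * (Real.sqrt (w a.1) * algD (bframe a) v Q) := by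
    intro a
    have h1 : Real.sqrt ((w a.1)⁻¹) * Real.sqrt (w a.1) = 1 := by
      rw [← Real.sqrt_mul (inv_nonneg.2 (hw a.1).le), inv_mul_cancel₀ (hw a.1).ne', Real.sqrt_one]
    linear_combination (-(algD (bframe a) u Q * algD (bframe a) v Q)) * h1
  have hG : Gam u v Q = ∑ a : BIdx ι N,
      (Real.sqrt ((w a.1)⁻¹) * algD (bframe a) u Q) * (Real.sqrt (w a.1) * algD (bframe a) v Q) := by
    simp only [Gam]
    exact sum_congr rfl fun a _ => key a
  have hU : GamW (fun e => (w e)⁻¹) u u Q = ∑ a : BIdx ι N, (Real.sqrt ((w a.1)⁻¹) * algD (bframe a) u Q) ^ 2 := by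
    rw [GamW_self_eq_sum_sq]
    refine sum_congr rfl fun a _ => ?_
    rw [mul_pow, Real.sq_sqrt (inv_nonneg.2 (hw a.1).le)]
  have hV : GamW w v v Q = ∑ a : BIdx ι N, (Real.sqrt (w a.1) * algD (bframe a) v Q) ^ 2 := by
    rw [GamW_self_eq_sum_sq]
    refine sum_congr rfl fun a _ => ?_
    rw [mul_pow, Real.sq_sqrt (hw a.1).le]
  rw [hG, hU, hV]
  have h := Real.sum_mul_le_sqrt_mul_sqrt univ
    (fun a : BIdx ι N => Real.sqrt ((w a.1)⁻¹) * algD (bframe a) u Q) (fun a => Real.sqrt (w a.1) * algD (bframe a) v Q)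
  have h' := Real.sum_mul_le_sqrt_mul_sqrt univ
    (fun a : BIdx ι N => -(Real.sqrt ((w a.1)⁻¹) * algD (bframe a) u Q)) (fun a => Real.sqrt (w a.1) * algD (bframe a) v Q)
  simp only [neg_mul, sum_neg_distrib, neg_sq] at h'
  exact abs_le.2 ⟨by linarith, h⟩

omit [DecidableEq ι] in
/-- Square roots of products with the weight. -/
private theorem sqrt_mul_sqrt_exp' (x y : ℝ) (hx : 0 ≤ x) (s : ℝ) :
    Real.sqrt (Real.exp s * x) * Real.sqrt (Real.exp s * y) = Real.exp s * Real.sqrt (x * y) := by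
  rw [← Real.sqrt_mul (mul_nonneg (Real.exp_pos s).le hx),
    show Real.exp s * x * (Real.exp s * y) = Real.exp s ^ 2 * (x * y) by ring,
    Real.sqrt_mul (sq_nonneg _), Real.sqrt_sq (Real.exp_pos s).le]

/-- **Mixed-weight Cauchy–Schwarz for `Γ` against `e^S μ`**:
`|∫ e^S Γ(u,v)| ≤ (∫ e^S Γ^{1/w}(u,u))^{1/2} (∫ e^S Γ^w(v,v))^{1/2}`. -/
theorem abs_integral_exp_mul_Gam_le_mixed (w : ι → ℝ) (hw : ∀ e, 0 < w e) {S u v : Cfg ι N → ℝ}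
    (hS : ContDiff ℝ ∞ S) (hu : ContDiff ℝ ∞ u) (hv : ContDiff ℝ ∞ v) (μ : Measure (PSU ι N)) [IsFiniteMeasure μ] :
    |∫ g : PSU ι N, Real.exp (S (emb g)) * Gam u v (emb g) ∂μ| ≤
      Real.sqrt (∫ g : PSU ι N, Real.exp (S (emb g)) * GamW (fun e => (w e)⁻¹) u u (emb g) ∂μ) *
        Real.sqrt (∫ g : PSU ι N, Real.exp (S (emb g)) * GamW w v v (emb g) ∂μ) := by
  have hw0 : ∀ e, 0 ≤ w e := fun e => (hw e).le
  have hwi : ∀ e, 0 ≤ (w e)⁻¹ := fun e => inv_nonneg.2 (hw0 e)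
  have hSc := continuous_restrict hS
  have hwu : Continuous fun g : PSU ι N => Real.sqrt (Real.exp (S (emb g)) * GamW (fun e => (w e)⁻¹) u u (emb g)) :=
    Real.continuous_sqrt.comp ((Real.continuous_exp.comp hSc).mul (continuous_restrict (contDiff_GamW _ hu hu)))
  have hwv : Continuous fun g : PSU ι N => Real.sqrt (Real.exp (S (emb g)) * GamW w v v (emb g)) :=
    Real.continuous_sqrt.comp ((Real.continuous_exp.comp hSc).mul (continuous_restrict (contDiff_GamW w hv hv)))
  have h := abs_integral_mul_le_sqrt hwu hwv μ
  have hnu : ∀ g : PSU ι N, 0 ≤ Real.exp (S (emb g)) * GamW (fun e => (w e)⁻¹) u u (emb g) := fun g =>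
    mul_nonneg (Real.exp_pos _).le (GamW_self_nonneg hwi _ _)
  have hnv : ∀ g : PSU ι N, 0 ≤ Real.exp (S (emb g)) * GamW w v v (emb g) := fun g =>
    mul_nonneg (Real.exp_pos _).le (GamW_self_nonneg hw0 _ _)
  simp only [Real.sq_sqrt (hnu _), Real.sq_sqrt (hnv _)] at h
  refine le_trans ?_ ((le_abs_self _).trans h)
  calc |∫ g : PSU ι N, Real.exp (S (emb g)) * Gam u v (emb g) ∂μ|
      ≤ ∫ g : PSU ι N, |Real.exp (S (emb g)) * Gam u v (emb g)| ∂μ := abs_integral_le_integral_abs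
    _ ≤ ∫ g : PSU ι N, Real.sqrt (Real.exp (S (emb g)) * GamW (fun e => (w e)⁻¹) u u (emb g)) *
          Real.sqrt (Real.exp (S (emb g)) * GamW w v v (emb g)) ∂μ := by
        refine integral_mono (integrable_of_continuous_PSU ((Real.continuous_exp.comp hSc).mul
          (continuous_restrict (contDiff_Gam hu hv))).abs μ) (integrable_of_continuous_PSU (hwu.mul hwv) μ)
          fun g => ?_
        rw [sqrt_mul_sqrt_exp' _ _ (GamW_self_nonneg hwi _ _), abs_mul, abs_of_pos (Real.exp_pos _)]
        have hG := abs_Gam_le_sqrt_GamW_inv w hw u v (emb g)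
        rw [← Real.sqrt_mul (GamW_self_nonneg hwi _ _)] at hG
        exact mul_le_mul_of_nonneg_left hG (Real.exp_pos _).le

/-! ### The weighted Dirichlet seminorm: Minkowski, constants, comparison with `Γ` -/

/-- `Γ^w(u+r, u+r) = Γ^w(u,u) + 2Γ^w(u,r) + Γ^w(r,r)`. -/
theorem GamW_add_add (w : ι → ℝ) {u r : Cfg ι N → ℝ} (hu : ContDiff ℝ ∞ u) (hr : ContDiff ℝ ∞ r) (Q : Cfg ι N) :
    GamW w (u + r) (u + r) Q = GamW w u u Q + 2 * GamW w u r Q + GamW w r r Q := by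
  simp only [GamW, algD_add hu hr, Pi.add_apply, mul_sum, ← sum_add_distrib]
  exact sum_congr rfl fun a _ => by ring

/-- `Γ^w(g - m, g - m) = Γ^w(g,g)` for a constant `m`. -/
theorem GamW_sub_const (w : ι → ℝ) {g : Cfg ι N → ℝ} (hg : ContDiff ℝ ∞ g) (m : ℝ) :
    GamW w (fun Q => g Q - m) (fun Q => g Q - m) = GamW w g g := by
  have h : ∀ A : Cfg ι N, algD A (fun Q => g Q - m) = algD A g := by
    intro A
    rw [show (fun Q => g Q - m) = g - fun _ => m from rfl, algD_sub hg contDiff_const, algD_const, sub_zero]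
  funext Q
  simp only [GamW, h]

/-- `Γ^w(r,r) ≤ C Γ(r,r)` when `w ≤ C`. -/
theorem GamW_le_const_mul_Gam {w : ι → ℝ} {C : ℝ} (hC : ∀ e, w e ≤ C) (r : Cfg ι N → ℝ) (Q : Cfg ι N) :
    GamW w r r Q ≤ C * Gam r r Q := by
  rw [GamW_self_eq_sum_sq, Gam_self_eq_sum_sq, mul_sum]
  exact sum_le_sum fun a _ => mul_le_mul_of_nonneg_right (hC a.1) (sq_nonneg _)

/-- **Minkowski for the weighted Dirichlet seminorm** `‖∇·‖_{w} = (∫ e^S Γ^w(·,·))^{1/2}`. -/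
theorem sqrt_integral_GamW_add_le {w : ι → ℝ} (hw : ∀ e, 0 ≤ w e) {S u r : Cfg ι N → ℝ}
    (hS : ContDiff ℝ ∞ S) (hu : ContDiff ℝ ∞ u) (hr : ContDiff ℝ ∞ r) :
    Real.sqrt (∫ x : PSU ι N, Real.exp (S (emb x)) * GamW w (u + r) (u + r) (emb x) ∂(haarPi ι N)) ≤
      Real.sqrt (∫ x : PSU ι N, Real.exp (S (emb x)) * GamW w u u (emb x) ∂(haarPi ι N)) +
        Real.sqrt (∫ x : PSU ι N, Real.exp (S (emb x)) * GamW w r r (emb x) ∂(haarPi ι N)) := by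
  have hEc : Continuous fun x : PSU ι N => Real.exp (S (emb x)) := Real.continuous_exp.comp (continuous_restrict hS)
  set A := ∫ x : PSU ι N, Real.exp (S (emb x)) * GamW w u u (emb x) ∂(haarPi ι N) with hA
  set B := ∫ x : PSU ι N, Real.exp (S (emb x)) * GamW w r r (emb x) ∂(haarPi ι N) with hB
  set C := ∫ x : PSU ι N, Real.exp (S (emb x)) * GamW w u r (emb x) ∂(haarPi ι N) with hCdef
  have hA0 : 0 ≤ A := integral_nonneg fun x => mul_nonneg (Real.exp_pos _).le (GamW_self_nonneg hw _ _)
  have hB0 : 0 ≤ B := integral_nonneg fun x => mul_nonneg (Real.exp_pos _).le (GamW_self_nonneg hw _ _)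
  have hC : |C| ≤ Real.sqrt A * Real.sqrt B := abs_integral_exp_mul_GamW_le hw hS hu hr _
  have i1 : Integrable (fun x : PSU ι N => Real.exp (S (emb x)) * GamW w u u (emb x)) (haarPi ι N) :=
    integrable_of_continuous_PSU (hEc.mul (continuous_restrict (contDiff_GamW w hu hu))) _
  have i2 : Integrable (fun x : PSU ι N => 2 * (Real.exp (S (emb x)) * GamW w u r (emb x))) (haarPi ι N) :=
    (integrable_of_continuous_PSU (hEc.mul (continuous_restrict (contDiff_GamW w hu hr))) _).const_mul 2
  have i3 : Integrable (fun x : PSU ι N => Real.exp (S (emb x)) * GamW w r r (emb x)) (haarPi ι N) :=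
    integrable_of_continuous_PSU (hEc.mul (continuous_restrict (contDiff_GamW w hr hr))) _
  have i12 : Integrable (fun x : PSU ι N => Real.exp (S (emb x)) * GamW w u u (emb x) +
      2 * (Real.exp (S (emb x)) * GamW w u r (emb x))) (haarPi ι N) := i1.add i2
  have hint : ∫ x : PSU ι N, Real.exp (S (emb x)) * GamW w (u + r) (u + r) (emb x) ∂(haarPi ι N) = A + 2 * C + B := by
    rw [hA, hB, hCdef, ← integral_const_mul, ← integral_add i1 i2, ← integral_add i12 i3]
    refine integral_congr_ae (ae_of_all _ fun x => ?_)
    simp only [GamW_add_add w hu hr]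
    ring
  have key : ∫ x : PSU ι N, Real.exp (S (emb x)) * GamW w (u + r) (u + r) (emb x) ∂(haarPi ι N) ≤
      (Real.sqrt A + Real.sqrt B) ^ 2 := by
    rw [hint, add_sq, Real.sq_sqrt hA0, Real.sq_sqrt hB0]
    nlinarith [(abs_le.1 hC).2]
  calc Real.sqrt (∫ x : PSU ι N, Real.exp (S (emb x)) * GamW w (u + r) (u + r) (emb x) ∂(haarPi ι N))
      ≤ Real.sqrt ((Real.sqrt A + Real.sqrt B) ^ 2) := Real.sqrt_le_sqrt key
    _ = Real.sqrt A + Real.sqrt B := Real.sqrt_sq (add_nonneg (Real.sqrt_nonneg _) (Real.sqrt_nonneg _))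

/-! ### One step of the covariance estimate -/

/-- **The covariance estimate with an approximate Poisson solution.** For smooth `f, g̃, u` and
`K = N/2 - Λ - (√ρ-1)H > 0`:
`K |∫ e^S f g̃| ≤ K ‖f‖ ‖L_S u - g̃‖ + ‖∇f‖_{w⁻¹} (‖∇g̃‖_w + (C ∫ e^S Γ(L_S u - g̃))^{1/2})`
(all norms in `L²(e^S σ^{⊗E})`, `w ≤ C`). -/
theorem cov_step (hN : N ≠ 0) {S : Cfg ι N → ℝ} (hS : ContDiff ℝ ∞ S)
    {Λ H ρ : ℝ} {h : ι → ι → ℝ} {w : ι → ℝ} (hHess : HessBound S Λ) (hOff : OffDiagHessBound S h)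
    (hh0 : ∀ e e', 0 ≤ h e e') (hsymm : ∀ e e', h e e' = h e' e) (hrow : ∀ e, ∑ e', h e e' ≤ H)
    (hρ : 1 ≤ ρ) (hw : AdmissibleWeights h ρ w) (hK : 0 < (N : ℝ) / 2 - Λ - (Real.sqrt ρ - 1) * H)
    {C : ℝ} (hC : ∀ e, w e ≤ C)
    {f gt u : Cfg ι N → ℝ} (hf : ContDiff ℝ ∞ f) (hgt : ContDiff ℝ ∞ gt) (hu : ContDiff ℝ ∞ u) :
    ((N : ℝ) / 2 - Λ - (Real.sqrt ρ - 1) * H) *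
        |∫ x : PSU ι N, Real.exp (S (emb x)) * (f (emb x) * gt (emb x)) ∂(haarPi ι N)| ≤
      ((N : ℝ) / 2 - Λ - (Real.sqrt ρ - 1) * H) *
          (Real.sqrt (∫ x : PSU ι N, Real.exp (S (emb x)) * f (emb x) ^ 2 ∂(haarPi ι N)) *
            Real.sqrt (∫ x : PSU ι N, Real.exp (S (emb x)) * (genL S u (emb x) - gt (emb x)) ^ 2 ∂(haarPi ι N))) +
        Real.sqrt (∫ x : PSU ι N, Real.exp (S (emb x)) * GamW (fun e => (w e)⁻¹) f f (emb x) ∂(haarPi ι N)) *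
          (Real.sqrt (∫ x : PSU ι N, Real.exp (S (emb x)) * GamW w gt gt (emb x) ∂(haarPi ι N)) +
            Real.sqrt (C * ∫ x : PSU ι N, Real.exp (S (emb x)) *
              Gam (fun Q => genL S u Q - gt Q) (fun Q => genL S u Q - gt Q) (emb x) ∂(haarPi ι N))) := by
  set K : ℝ := (N : ℝ) / 2 - Λ - (Real.sqrt ρ - 1) * H with hKdef
  have hw0 : ∀ e, 0 ≤ w e := fun e => (hw.1 e).le
  have hSc : Continuous fun x : PSU ι N => S (emb x) := continuous_restrict hS
  have hEc : Continuous fun x : PSU ι N => Real.exp (S (emb x)) := Real.continuous_exp.comp hSc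
  have hLc : ContDiff ℝ ∞ (genL S u) := contDiff_genL hS hu
  have hr : ContDiff ℝ ∞ (fun Q => genL S u Q - gt Q) := hLc.sub hgt
  -- names for the pieces
  set I := ∫ x : PSU ι N, Real.exp (S (emb x)) * (f (emb x) * gt (emb x)) ∂(haarPi ι N) with hI
  set D := ∫ x : PSU ι N, Real.exp (S (emb x)) * (f (emb x) * (genL S u (emb x) - gt (emb x))) ∂(haarPi ι N) with hD
  set G := ∫ x : PSU ι N, Real.exp (S (emb x)) * Gam f u (emb x) ∂(haarPi ι N) with hG
  set F2 := ∫ x : PSU ι N, Real.exp (S (emb x)) * f (emb x) ^ 2 ∂(haarPi ι N) with hF2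
  set E1 := ∫ x : PSU ι N, Real.exp (S (emb x)) * (genL S u (emb x) - gt (emb x)) ^ 2 ∂(haarPi ι N) with hE1
  set Af := Real.sqrt (∫ x : PSU ι N, Real.exp (S (emb x)) * GamW (fun e => (w e)⁻¹) f f (emb x) ∂(haarPi ι N))
    with hAf
  set Vu := ∫ x : PSU ι N, Real.exp (S (emb x)) * GamW w u u (emb x) ∂(haarPi ι N) with hVu
  set VL := ∫ x : PSU ι N, Real.exp (S (emb x)) * GamW w (genL S u) (genL S u) (emb x) ∂(haarPi ι N) with hVL
  set Bg := Real.sqrt (∫ x : PSU ι N, Real.exp (S (emb x)) * GamW w gt gt (emb x) ∂(haarPi ι N)) with hBg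
  set E2 := ∫ x : PSU ι N, Real.exp (S (emb x)) *
    Gam (fun Q => genL S u Q - gt Q) (fun Q => genL S u Q - gt Q) (emb x) ∂(haarPi ι N) with hE2
  -- (a) `I = -G - D`
  have iL : Integrable (fun x : PSU ι N => f (emb x) * (Real.exp (S (emb x)) * genL S u (emb x))) (haarPi ι N) :=
    integrable_of_continuous_PSU ((continuous_restrict hf).mul (hEc.mul (continuous_restrict hLc))) _
  have iD : Integrable (fun x : PSU ι N => Real.exp (S (emb x)) * (f (emb x) * (genL S u (emb x) - gt (emb x))))
      (haarPi ι N) :=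
    integrable_of_continuous_PSU (hEc.mul ((continuous_restrict hf).mul (continuous_restrict hr))) _
  have ha : I = -G - D := by
    have e1 : I = (∫ x : PSU ι N, f (emb x) * (Real.exp (S (emb x)) * genL S u (emb x)) ∂(haarPi ι N)) - D := by
      rw [hI, hD, ← integral_sub iL iD]
      exact integral_congr_ae (ae_of_all _ fun x => by ring)
    rw [e1, integral_mul_exp_mul_genL hN hS hf hu]
  -- (b) `|D| ≤ √F2 √E1`
  have hb : |D| ≤ Real.sqrt F2 * Real.sqrt E1 :=
    abs_integral_exp_mul_mul_le (S := fun x : PSU ι N => S (emb x)) (f := fun x => f (emb x))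
      (g := fun x => genL S u (emb x) - gt (emb x)) hSc (continuous_restrict hf) (continuous_restrict hr) _
  -- (c) `|G| ≤ Af √Vu`
  have hc : |G| ≤ Af * Real.sqrt Vu := abs_integral_exp_mul_Gam_le_mixed w hw.1 hS hf hu _
  -- (d) `K √Vu ≤ √VL`
  have hd : K * Real.sqrt Vu ≤ Real.sqrt VL := by
    have hen := weightedEnergy_le hN hS hu hHess hOff hh0 hsymm hrow hρ hw hK.le
    calc K * Real.sqrt Vu = Real.sqrt (K ^ 2) * Real.sqrt Vu := by rw [Real.sqrt_sq hK.le]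
      _ = Real.sqrt (K ^ 2 * Vu) := (Real.sqrt_mul (sq_nonneg _) Vu).symm
      _ ≤ Real.sqrt VL := Real.sqrt_le_sqrt hen
  -- (e) `√VL ≤ Bg + √(∫ e^S Γ^w(r,r))`
  have he : Real.sqrt VL ≤ Bg + Real.sqrt (∫ x : PSU ι N, Real.exp (S (emb x)) *
      GamW w (fun Q => genL S u Q - gt Q) (fun Q => genL S u Q - gt Q) (emb x) ∂(haarPi ι N)) := by
    have hM := sqrt_integral_GamW_add_le hw0 hS hgt hr (u := gt) (r := fun Q => genL S u Q - gt Q)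
    have eL : (gt + fun Q => genL S u Q - gt Q) = genL S u := by
      funext Q; simp only [Pi.add_apply]; ring
    rw [eL] at hM
    rw [hVL, hBg]
    exact hM
  -- (f) `∫ e^S Γ^w(r,r) ≤ C E2`
  have hf' : ∫ x : PSU ι N, Real.exp (S (emb x)) *
      GamW w (fun Q => genL S u Q - gt Q) (fun Q => genL S u Q - gt Q) (emb x) ∂(haarPi ι N) ≤ C * E2 := by
    rw [hE2, ← integral_const_mul]
    refine integral_mono (integrable_of_continuous_PSU (hEc.mul (continuous_restrict (contDiff_GamW w hr hr))) _)
      ((integrable_of_continuous_PSU (hEc.mul (continuous_restrict (contDiff_Gam hr hr))) _).const_mul C)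
      fun x => ?_
    have := GamW_le_const_mul_Gam hC (fun Q => genL S u Q - gt Q) (emb x)
    have hpos := Real.exp_pos (S (emb x))
    nlinarith
  -- assemble
  have hAf0 : 0 ≤ Af := Real.sqrt_nonneg _
  have h1 : |I| ≤ |G| + |D| := by
    rw [ha]
    have := abs_add_le (-G) (-D)
    rwa [abs_neg, abs_neg, ← sub_eq_add_neg] at this
  have h2 : K * |G| ≤ Af * (Bg + Real.sqrt (C * E2)) := by
    have h21 : K * |G| ≤ Af * (K * Real.sqrt Vu) := by nlinarith [hc, hK.le, Real.sqrt_nonneg Vu]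
    have h22 : K * Real.sqrt Vu ≤ Bg + Real.sqrt (C * E2) :=
      hd.trans (he.trans (add_le_add le_rfl (Real.sqrt_le_sqrt hf')))
    exact h21.trans (mul_le_mul_of_nonneg_left h22 hAf0)
  calc K * |I| ≤ K * (|G| + |D|) := mul_le_mul_of_nonneg_left h1 hK.le
    _ = K * |D| + K * |G| := by ring
    _ ≤ K * (Real.sqrt F2 * Real.sqrt E1) + Af * (Bg + Real.sqrt (C * E2)) :=
        add_le_add (mul_le_mul_of_nonneg_left hb hK.le) h2

/-! ### The covariance bound -/

/-- **The weighted covariance bound for the Gibbs measure `e^S σ^{⊗E}` on `SU(N)^E`.** Under the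
hypotheses of the weighted energy estimate (`HessBound S Λ`, `OffDiagHessBound S h` with `h ≥ 0`
symmetric and row sums `≤ H`, admissible weights `w` of ratio `ρ ≥ 1`) and
`K = N/2 - Λ - (√ρ - 1)H > 0`, for all smooth `f, g`:
`K · |Z ∫ e^S fg - (∫ e^S f)(∫ e^S g)| ≤ Z · (∫ e^S Γ^{1/w}(f,f))^{1/2} (∫ e^S Γ^{w}(g,g))^{1/2}`,
`Z = ∫ e^S dσ^{⊗E}`. -/
theorem covariance_le (hN : N ≠ 0) {dS : ℕ} {S : Cfg ι N → ℝ} (hSp : S ∈ polySpace ι N dS)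
    {Λ H ρ : ℝ} {h : ι → ι → ℝ} {w : ι → ℝ} (hHess : HessBound S Λ) (hOff : OffDiagHessBound S h)
    (hh0 : ∀ e e', 0 ≤ h e e') (hsymm : ∀ e e', h e e' = h e' e) (hrow : ∀ e, ∑ e', h e e' ≤ H)
    (hρ : 1 ≤ ρ) (hw : AdmissibleWeights h ρ w) (hK : 0 < (N : ℝ) / 2 - Λ - (Real.sqrt ρ - 1) * H)
    {f g : Cfg ι N → ℝ} (hf : ContDiff ℝ ∞ f) (hg : ContDiff ℝ ∞ g) :
    ((N : ℝ) / 2 - Λ - (Real.sqrt ρ - 1) * H) *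
        |(∫ x : PSU ι N, Real.exp (S (emb x)) ∂(haarPi ι N)) *
            (∫ x : PSU ι N, Real.exp (S (emb x)) * (f (emb x) * g (emb x)) ∂(haarPi ι N)) -
          (∫ x : PSU ι N, Real.exp (S (emb x)) * f (emb x) ∂(haarPi ι N)) *
            (∫ x : PSU ι N, Real.exp (S (emb x)) * g (emb x) ∂(haarPi ι N))| ≤
      (∫ x : PSU ι N, Real.exp (S (emb x)) ∂(haarPi ι N)) *
        (Real.sqrt (∫ x : PSU ι N, Real.exp (S (emb x)) * GamW (fun e => (w e)⁻¹) f f (emb x) ∂(haarPi ι N)) *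
          Real.sqrt (∫ x : PSU ι N, Real.exp (S (emb x)) * GamW w g g (emb x) ∂(haarPi ι N))) := by
  set K : ℝ := (N : ℝ) / 2 - Λ - (Real.sqrt ρ - 1) * H with hKdef
  have hS : ContDiff ℝ ∞ S := contDiff_of_mem_polySpace hSp
  have hSc : Continuous fun x : PSU ι N => S (emb x) := continuous_restrict hS
  have hEc : Continuous fun x : PSU ι N => Real.exp (S (emb x)) := Real.continuous_exp.comp hSc
  have hw0 : ∀ e, 0 ≤ w e := fun e => (hw.1 e).le
  set Z : ℝ := ∫ x : PSU ι N, Real.exp (S (emb x)) ∂(haarPi ι N) with hZ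
  have hZpos : 0 < Z := integral_exp_pos (integrable_of_continuous_PSU hEc _)
  have hZne : Z ≠ 0 := hZpos.ne'
  set m : ℝ := (∫ x : PSU ι N, Real.exp (S (emb x)) * g (emb x) ∂(haarPi ι N)) / Z with hm
  have hgm : ContDiff ℝ ∞ (fun Q => g Q - m) := hg.sub contDiff_const
  set Af := Real.sqrt (∫ x : PSU ι N, Real.exp (S (emb x)) * GamW (fun e => (w e)⁻¹) f f (emb x) ∂(haarPi ι N))
    with hAf
  set Bg := Real.sqrt (∫ x : PSU ι N, Real.exp (S (emb x)) * GamW w g g (emb x) ∂(haarPi ι N)) with hBg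
  set I : ℝ := ∫ x : PSU ι N, Real.exp (S (emb x)) * (f (emb x) * (g (emb x) - m)) ∂(haarPi ι N) with hI
  -- the covariance identity
  have hcov : Z * (∫ x : PSU ι N, Real.exp (S (emb x)) * (f (emb x) * g (emb x)) ∂(haarPi ι N)) -
      (∫ x : PSU ι N, Real.exp (S (emb x)) * f (emb x) ∂(haarPi ι N)) *
        (∫ x : PSU ι N, Real.exp (S (emb x)) * g (emb x) ∂(haarPi ι N)) = Z * I := by
    have i1 : Integrable (fun x : PSU ι N => Real.exp (S (emb x)) * (f (emb x) * g (emb x))) (haarPi ι N) :=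
      integrable_of_continuous_PSU (hEc.mul ((continuous_restrict hf).mul (continuous_restrict hg))) _
    have i2 : Integrable (fun x : PSU ι N => m * (Real.exp (S (emb x)) * f (emb x))) (haarPi ι N) :=
      (integrable_of_continuous_PSU (hEc.mul (continuous_restrict hf)) _).const_mul m
    have e1 : I = (∫ x : PSU ι N, Real.exp (S (emb x)) * (f (emb x) * g (emb x)) ∂(haarPi ι N)) -
        m * ∫ x : PSU ι N, Real.exp (S (emb x)) * f (emb x) ∂(haarPi ι N) := by
      rw [hI, ← integral_const_mul, ← integral_sub i1 i2]
      exact integral_congr_ae (ae_of_all _ fun x => by ring)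
    have e2 : m * Z = ∫ x : PSU ι N, Real.exp (S (emb x)) * g (emb x) ∂(haarPi ι N) := by
      rw [hm, div_mul_cancel₀ _ hZne]
    rw [e1, mul_sub, ← e2]
    ring
  -- `g - m` is centred
  have hmean : ∫ x : PSU ι N, Real.exp (S (emb x)) * (g (emb x) - m) ∂(haarPi ι N) = 0 := by
    have i1 : Integrable (fun x : PSU ι N => Real.exp (S (emb x)) * g (emb x)) (haarPi ι N) :=
      integrable_of_continuous_PSU (hEc.mul (continuous_restrict hg)) _
    have i2 : Integrable (fun x : PSU ι N => m * Real.exp (S (emb x))) (haarPi ι N) :=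
      (integrable_of_continuous_PSU hEc _).const_mul m
    have e1 : ∫ x : PSU ι N, Real.exp (S (emb x)) * (g (emb x) - m) ∂(haarPi ι N) =
        (∫ x : PSU ι N, Real.exp (S (emb x)) * g (emb x) ∂(haarPi ι N)) - m * Z := by
      rw [hZ, ← integral_const_mul, ← integral_sub i1 i2]
      exact integral_congr_ae (ae_of_all _ fun x => by ring)
    rw [e1, hm, div_mul_cancel₀ _ hZne, sub_self]
  -- approximate Poisson solutions and the per-step estimate
  obtain ⟨v, hvc, t1, t2⟩ := exists_approx_poisson hN hSp hg hmean
  obtain ⟨C, hC⟩ : ∃ C : ℝ, ∀ e, w e ≤ C :=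
    ⟨∑ e, w e, fun e => single_le_sum (fun e _ => hw0 e) (mem_univ e)⟩
  set F2 := ∫ x : PSU ι N, Real.exp (S (emb x)) * f (emb x) ^ 2 ∂(haarPi ι N) with hF2
  have hBg' : Real.sqrt (∫ x : PSU ι N, Real.exp (S (emb x)) *
      GamW w (fun Q => g Q - m) (fun Q => g Q - m) (emb x) ∂(haarPi ι N)) = Bg := by
    rw [hBg, GamW_sub_const w hg m]
  have hstep : ∀ k, K * |I| ≤ K * (Real.sqrt F2 * Real.sqrt (∫ x : PSU ι N, Real.exp (S (emb x)) *
      (genL S (v k) (emb x) - (g (emb x) - m)) ^ 2 ∂(haarPi ι N))) +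
        Af * (Bg + Real.sqrt (C * ∫ x : PSU ι N, Real.exp (S (emb x)) *
          Gam (fun Q => genL S (v k) Q - (g Q - m)) (fun Q => genL S (v k) Q - (g Q - m)) (emb x) ∂(haarPi ι N))) := by
    intro k
    have := cov_step hN hS hHess hOff hh0 hsymm hrow hρ hw hK hC hf hgm (hvc k)
    rw [hBg'] at this
    exact this
  -- pass to the limit
  have hlim : Tendsto (fun k => K * (Real.sqrt F2 * Real.sqrt (∫ x : PSU ι N, Real.exp (S (emb x)) *
      (genL S (v k) (emb x) - (g (emb x) - m)) ^ 2 ∂(haarPi ι N))) +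
        Af * (Bg + Real.sqrt (C * ∫ x : PSU ι N, Real.exp (S (emb x)) *
          Gam (fun Q => genL S (v k) Q - (g Q - m)) (fun Q => genL S (v k) Q - (g Q - m)) (emb x) ∂(haarPi ι N))))
      atTop (𝓝 (K * (Real.sqrt F2 * 0) + Af * (Bg + 0))) := by
    have s1 : Tendsto (fun k => Real.sqrt (∫ x : PSU ι N, Real.exp (S (emb x)) *
        (genL S (v k) (emb x) - (g (emb x) - m)) ^ 2 ∂(haarPi ι N))) atTop (𝓝 0) := by
      have := (Real.continuous_sqrt.tendsto 0).comp t1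
      rwa [Real.sqrt_zero] at this
    have s2 : Tendsto (fun k => Real.sqrt (C * ∫ x : PSU ι N, Real.exp (S (emb x)) *
        Gam (fun Q => genL S (v k) Q - (g Q - m)) (fun Q => genL S (v k) Q - (g Q - m)) (emb x) ∂(haarPi ι N)))
        atTop (𝓝 0) := by
      have t2' : Tendsto (fun k => C * ∫ x : PSU ι N, Real.exp (S (emb x)) *
          Gam (fun Q => genL S (v k) Q - (g Q - m)) (fun Q => genL S (v k) Q - (g Q - m)) (emb x) ∂(haarPi ι N))
          atTop (𝓝 0) := by simpa using t2.const_mul C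
      have := (Real.continuous_sqrt.tendsto 0).comp t2'
      rwa [Real.sqrt_zero] at this
    exact ((s1.const_mul _).const_mul _).add ((s2.const_add _).const_mul _)
  have hfinal : K * |I| ≤ K * (Real.sqrt F2 * 0) + Af * (Bg + 0) :=
    le_of_tendsto_of_tendsto' tendsto_const_nhds hlim hstep
  rw [mul_zero, mul_zero, zero_add, add_zero] at hfinal
  -- conclude
  rw [hcov, abs_mul, abs_of_pos hZpos]
  calc K * (Z * |I|) = Z * (K * |I|) := by ring
    _ ≤ Z * (Af * Bg) := mul_le_mul_of_nonneg_left hfinal hZpos.le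

end SharpClustering

end Summit.Ventures.YMGap
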